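import Literature.NumberTheory.GelbartRogawski1991.LocalDoubledRationalFrameSiegel
import Literature.NumberTheory.GelbartRogawski1991.LocalDoubledRationalFrameModels
import Literature.NumberTheory.GelbartRogawski1991.LocalUnitaryBlockRestriction
import Literature.NumberTheory.GelbartRogawski1991.LocalDoubledDiagonalEigenlaw
import HarnessLib

/-!
# The BLOCK SWAP of the doubled datum as a rational frame `Q`: `Qᵀ · (T₀ ⊕ −T₀) · Q = (−T₀) ⊕ T₀`, and its Siegel bookkeeping

For Kudla's doubled hermitian datum `T₀^𝔻 = T₀ ⊕ (−T₀)` [Kudla1994, §2; HarrisKudlaSweet1996, (1.9)] the block swap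
`Q = reindex_{e₂} (0 1; 1 0) ∈ GL_{n+n}(F)` (`swapQ`, an involution) is a RATIONAL FRAME in the sense of ★ `FrameTransport`
(`LocalUnitaryFrameTransport`) from the doubled datum of `T₀` to the doubled datum of `−T₀`:
`Qᵀ · gramD T₀ · Q = gramD (−T₀)` (`transpose_swapQ_mul_gramD_mul_swapQ`). This file is the `Q`-analogue of the diagonal-frame
bookkeeping ★ `LocalDoubledRationalFrameSiegel` / ★ `LocalDoubledRationalFrameModels` (there the frame is `P ⊕ P`):

* §2 `reindex_coe_frameConj_swapQ`: the `e₂`-blocks of `(Q h Q⁻¹)_w` are `(D C; B A)` for `h_w = (A B; C D)`; hence `Ad(Q)` preserves the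
  Siegel parabolic `P_Δ` (`isSiegelDelta_frameConj_swapQ_iff` — the block condition `A + B = C + D` is swap-invariant), the `Δ`-block
  (`deltaBlock_frameConj_swapQ`), `det_Δ` and `χ_v(det_Δ)` (`detDelta_frameConj_swapQ`, `chiDet_frameConj_swapQ`);
* §3 `frameConj_swapQ_inlLoc`: `Q (g ⊕ 1) Q⁻¹ = 1 ⊕ g` — the first-block embedding of the datum of `−T₀` goes to the SECOND-block embedding
  of the datum of `T₀`; `map_frameW_swapQ_deltaLagrangian`: the symplectic frame map preserves `ℓ_Δ` (so `frameMp_Q` carries movers of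
  `ℓ_Δ ↦ ℓ_Y` to movers, `map_proj_frameMp_swapQ_deltaLagrangian`); `frameOp_swapQ_boxSB`: the frame operator on the mixed model
  `𝒮(F_v^{n+n}) = 𝒮(F_vⁿ) ⊗̂ 𝒮(F_vⁿ)` exchanges the tensor factors, `frameOp_Q (f₁ ⊠ f₂) = f₂ ⊠ f₁` [MVW, Chap. 2 II.1 Rem. (6)].

Used downstream to transport Kudla's CM splitting along the swap (`frameSection_Q Σ_{T₀} = Σ_{−T₀}` by the rigidity ★
`eq_of_parabolic_toRep_conj_eq`) and so to identify the SECOND block `restrictRight Σ_{T₀}` of the doubled CM section with the undoubled CM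
section of `−T₀` — the transport (T1) of the block-types duality ★ `LocalDoubledBlockTypesDualityUndoubled`.
-/

set_option autoImplicit false

noncomputable section

open scoped Matrix
open NumberField IsDedekindDomain Matrix
open Literature.RepresentationTheory.HeisenbergGroup
open Literature.NumberTheory.Automorphic Literature.NumberTheory.Automorphic.UnitaryGroup

namespace Literature.NumberTheory.GelbartRogawski1991.UnitaryDualPair.LocalSplitting

/-! ## §0 Block algebra of the swap -/

section Blocks

variable {R : Type*} [CommRing R] {m : Type*} [Fintype m] [DecidableEq m]

/-- `(0 1; 1 0)² = 1`. [cite: Kudla1994, §2 (doubled space, Siegel parabolic)] -/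
theorem fromBlocks_swap_mul_swap :
    Matrix.fromBlocks (0 : Matrix m m R) (1 : Matrix m m R) (1 : Matrix m m R) (0 : Matrix m m R) *
      Matrix.fromBlocks (0 : Matrix m m R) (1 : Matrix m m R) (1 : Matrix m m R) (0 : Matrix m m R) = 1 := by
  rw [Matrix.fromBlocks_multiply]
  simp only [Matrix.zero_mul, Matrix.mul_zero, Matrix.one_mul, zero_add, add_zero, Matrix.fromBlocks_one]

/-- conjugating a block matrix by the swap exchanges the blocks: `(0 1; 1 0)(A B; C D)(0 1; 1 0) = (D C; B A)`.
[cite: Kudla1994, §2 (doubled space, Siegel parabolic)] -/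
theorem fromBlocks_swap_conj (M : Matrix (m ⊕ m) (m ⊕ m) R) :
    Matrix.fromBlocks (0 : Matrix m m R) (1 : Matrix m m R) (1 : Matrix m m R) (0 : Matrix m m R) * M *
      Matrix.fromBlocks (0 : Matrix m m R) (1 : Matrix m m R) (1 : Matrix m m R) (0 : Matrix m m R) =
      Matrix.fromBlocks M.toBlocks₂₂ M.toBlocks₂₁ M.toBlocks₁₂ M.toBlocks₁₁ := by
  conv_lhs => rw [← Matrix.fromBlocks_toBlocks M]
  rw [Matrix.fromBlocks_multiply, Matrix.fromBlocks_multiply]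
  simp only [Matrix.zero_mul, Matrix.mul_zero, Matrix.one_mul, Matrix.mul_one, zero_add, add_zero]

/-- `submatrix` along an equivalence is multiplicative (three factors). [cite: Kudla1994, §2 (doubled space, Siegel parabolic)] -/
private theorem submatrix_mul_mul'' {l m' : Type*} [Fintype l] [DecidableEq l] [Fintype m'] [DecidableEq m'] (e : l ≃ m')
    (A B C : Matrix m' m' R) :
    (A * B * C).submatrix e e = A.submatrix e e * B.submatrix e e * C.submatrix e e := by
  rw [Matrix.submatrix_mul_equiv, Matrix.submatrix_mul_equiv]

/-- a linear automorphism preserving a submodule in both directions fixes it. [folklore] -/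
private theorem map_eq_of_mapsTo' {K : Type*} [Field K] {M : Type*} [AddCommGroup M] [Module K M] (S : Submodule K M) (e : M ≃ₗ[K] M)
    (h₁ : ∀ x ∈ S, e x ∈ S) (h₂ : ∀ x ∈ S, e.symm x ∈ S) : S.map (e : M →ₗ[K] M) = S := by
  refine le_antisymm ?_ fun x hx => ⟨e.symm x, h₂ x hx, e.apply_symm_apply x⟩
  rintro _ ⟨x, hx, rfl⟩
  exact h₁ x hx

end Blocks

variable (F : Type) [Field F] [NumberField F] (E : Type) [Field E] [NumberField E] [Algebra F E]
  (c : E ≃ₐ[F] E) (v : HeightOneSpectrum (𝓞 F)) (n : ℕ) {T₀ : Matrix (Fin n) (Fin n) F}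
  {JD : Matrix (Fin (n + n)) (Fin (n + n)) E} (hJD : JD = (gramD F n T₀).map (algebraMap F E))
  {JD' : Matrix (Fin (n + n)) (Fin (n + n)) E} (hJD' : JD' = (gramD F n (-T₀)).map (algebraMap F E))

/-! ## §1 The swap frame `Q` -/

/-- **the block swap `Q = reindex_{e₂} (0 1; 1 0) ∈ GL_{n+n}(F)`** (an involution: `Q⁻¹ = Q`). [cite: Kudla1994, §2 (doubled space, Siegel parabolic)] -/
def swapQ : GL (Fin (n + n)) F :=
  ⟨Matrix.reindex (e₂ n) (e₂ n) (Matrix.fromBlocks (0 : Matrix (Fin n) (Fin n) F) (1 : Matrix (Fin n) (Fin n) F) 1 0),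
   Matrix.reindex (e₂ n) (e₂ n) (Matrix.fromBlocks (0 : Matrix (Fin n) (Fin n) F) (1 : Matrix (Fin n) (Fin n) F) 1 0),
   by rw [Matrix.reindex_apply, Matrix.submatrix_mul_equiv, fromBlocks_swap_mul_swap, Matrix.submatrix_one_equiv],
   by rw [Matrix.reindex_apply, Matrix.submatrix_mul_equiv, fromBlocks_swap_mul_swap, Matrix.submatrix_one_equiv]⟩

omit [NumberField F] in
/-- matrix of `Q`. [cite: Kudla1994, §2 (doubled space, Siegel parabolic)] -/
@[simp] theorem coe_swapQ : ((swapQ F n : GL (Fin (n + n)) F) : Matrix (Fin (n + n)) (Fin (n + n)) F) =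
    Matrix.reindex (e₂ n) (e₂ n) (Matrix.fromBlocks (0 : Matrix (Fin n) (Fin n) F) (1 : Matrix (Fin n) (Fin n) F) 1 0) := rfl

omit [NumberField F] in
/-- `Q⁻¹ = Q`. [cite: Kudla1994, §2 (doubled space, Siegel parabolic)] -/
theorem swapQ_inv : (swapQ F n)⁻¹ = swapQ F n := Units.ext rfl

omit [NumberField F] in
/-- `Qᵀ = Q`. [cite: Kudla1994, §2 (doubled space, Siegel parabolic)] -/
theorem transpose_coe_swapQ : ((swapQ F n : GL (Fin (n + n)) F) : Matrix (Fin (n + n)) (Fin (n + n)) F)ᵀ = swapQ F n := by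
  rw [coe_swapQ, Matrix.reindex_apply, Matrix.transpose_submatrix, Matrix.fromBlocks_transpose]
  simp only [Matrix.transpose_zero, Matrix.transpose_one]

omit [NumberField F] in
/-- **`Qᵀ · (T₀ ⊕ −T₀) · Q = (−T₀) ⊕ T₀ = (−T₀)^𝔻`**: the block swap is a rational frame from the doubled Gram matrix of `T₀` to that of `−T₀`.
[cite: HarrisKudlaSweet1996, §1 (1.9)] [cite: Kudla1994, §2 (doubled space, Siegel parabolic)] -/
theorem transpose_swapQ_mul_gramD_mul_swapQ :
    ((swapQ F n : GL (Fin (n + n)) F) : Matrix (Fin (n + n)) (Fin (n + n)) F)ᵀ * gramD F n T₀ *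
        ((swapQ F n : GL (Fin (n + n)) F) : Matrix (Fin (n + n)) (Fin (n + n)) F) = gramD F n (-T₀) := by
  rw [transpose_coe_swapQ, coe_swapQ, gramD, gramD, Matrix.reindex_apply, Matrix.reindex_apply, Matrix.reindex_apply,
    ← submatrix_mul_mul'', fromBlocks_swap_conj, Matrix.toBlocks_fromBlocks₂₂, Matrix.toBlocks_fromBlocks₂₁, Matrix.toBlocks_fromBlocks₁₂,
    Matrix.toBlocks_fromBlocks₁₁, neg_neg]

omit [NumberField F] in
/-- the matrix of `Q` over any `F`-algebra is again `reindex_{e₂} (0 1; 1 0)`. [cite: Kudla1994, §2 (doubled space, Siegel parabolic)] -/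
theorem map_coe_swapQ {S : Type*} [CommRing S] (f : F →+* S) :
    ((swapQ F n : GL (Fin (n + n)) F) : Matrix (Fin (n + n)) (Fin (n + n)) F).map f =
      Matrix.reindex (e₂ n) (e₂ n) (Matrix.fromBlocks (0 : Matrix (Fin n) (Fin n) S) (1 : Matrix (Fin n) (Fin n) S) 1 0) := by
  rw [coe_swapQ]
  ext i j
  simp only [Matrix.map_apply, Matrix.reindex_apply, Matrix.submatrix_apply]
  rcases (e₂ n).symm i with a | a <;> rcases (e₂ n).symm j with b | b <;>
    simp [Matrix.fromBlocks, Matrix.one_apply, apply_ite f, map_one, map_zero]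

omit [NumberField F] in
/-- the matrix of `Q` at a place `w ∣ v`. [cite: PlatonovRapinchuk1994, §5.1] -/
theorem coe_map_swapQ (w : PlacesOver E v) :
    ((Matrix.GeneralLinearGroup.map (algebraMap E (w.1.adicCompletion E)) (Matrix.GeneralLinearGroup.map (algebraMap F E) (swapQ F n)) :
        GL (Fin (n + n)) (w.1.adicCompletion E)) : Matrix (Fin (n + n)) (Fin (n + n)) (w.1.adicCompletion E)) =
      Matrix.reindex (e₂ n) (e₂ n) (Matrix.fromBlocks (0 : Matrix (Fin n) (Fin n) (w.1.adicCompletion E)) (1 : Matrix (Fin n) (Fin n) _) 1 0) := by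
  rw [← Matrix.GeneralLinearGroup.map_comp_apply]
  exact map_coe_swapQ F n ((algebraMap E (w.1.adicCompletion E)).comp (algebraMap F E))

omit [NumberField F] in
/-- the matrix of `Q⁻¹` at a place `w ∣ v` (the same). [cite: PlatonovRapinchuk1994, §5.1] -/
theorem coe_map_swapQ_inv (w : PlacesOver E v) :
    (((Matrix.GeneralLinearGroup.map (algebraMap E (w.1.adicCompletion E)) (Matrix.GeneralLinearGroup.map (algebraMap F E) (swapQ F n)))⁻¹ :
        GL (Fin (n + n)) (w.1.adicCompletion E)) : Matrix (Fin (n + n)) (Fin (n + n)) (w.1.adicCompletion E)) =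
      Matrix.reindex (e₂ n) (e₂ n) (Matrix.fromBlocks (0 : Matrix (Fin n) (Fin n) (w.1.adicCompletion E)) (1 : Matrix (Fin n) (Fin n) _) 1 0) := by
  rw [← map_inv, ← map_inv, swapQ_inv]
  exact coe_map_swapQ F E v n w

/-! ## §2 `Ad(Q)` at a place: blocks, `P_Δ`, `det_Δ`, `χ(det_Δ)` -/

section PlaceBlocks

/-- **the `e₂`-blocks of `(Q h Q⁻¹)_w` are the swapped blocks of `h_w`**: `(A B; C D) ↦ (D C; B A)`. [cite: Kudla1994, §2 (doubled space, Siegel parabolic)] -/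
theorem reindex_coe_frameConj_swapQ (h : localPi E c (n + n) JD' v) (w : PlacesOver E v) :
    Matrix.reindex (e₂ n).symm (e₂ n).symm
        (((FrameTransport.frameConj F E c v (n + n) hJD hJD' (swapQ F n) (transpose_swapQ_mul_gramD_mul_swapQ F n) h :
            localPi E c (n + n) JD v) : LocalGLPi E (n + n) v) w : Matrix (Fin (n + n)) (Fin (n + n)) (w.1.adicCompletion E)) =
      Matrix.fromBlocks
        (Matrix.reindex (e₂ n).symm (e₂ n).symm (((h : LocalGLPi E (n + n) v) w : GL (Fin (n + n)) (w.1.adicCompletion E)) :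
          Matrix _ _ (w.1.adicCompletion E))).toBlocks₂₂
        (Matrix.reindex (e₂ n).symm (e₂ n).symm (((h : LocalGLPi E (n + n) v) w : GL (Fin (n + n)) (w.1.adicCompletion E)) :
          Matrix _ _ (w.1.adicCompletion E))).toBlocks₂₁
        (Matrix.reindex (e₂ n).symm (e₂ n).symm (((h : LocalGLPi E (n + n) v) w : GL (Fin (n + n)) (w.1.adicCompletion E)) :
          Matrix _ _ (w.1.adicCompletion E))).toBlocks₁₂
        (Matrix.reindex (e₂ n).symm (e₂ n).symm (((h : LocalGLPi E (n + n) v) w : GL (Fin (n + n)) (w.1.adicCompletion E)) :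
          Matrix _ _ (w.1.adicCompletion E))).toBlocks₁₁ := by
  rw [coe_frameConj_apply_apply, Units.val_mul, Units.val_mul, coe_map_swapQ F E v n w, coe_map_swapQ_inv F E v n w, ← fromBlocks_swap_conj]
  simp only [Matrix.reindex_apply, Equiv.symm_symm, submatrix_mul_mul'', Matrix.submatrix_submatrix, Equiv.symm_comp_self,
    Matrix.submatrix_id_id]

/-- **`P_Δ` is carried to `P_Δ`**: `Q h Q⁻¹ ∈ P_Δ(T₀^𝔻) ↔ h ∈ P_Δ((−T₀)^𝔻)` (the block condition `h₁₁ + h₁₂ = h₂₁ + h₂₂` is swap-invariant).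
[cite: Kudla1994, §2, §3] [cite: HarrisKudlaSweet1996, §1 (1.11)] -/
theorem isSiegelDelta_frameConj_swapQ_iff [Algebra.IsQuadraticExtension F E] {δ : E} (hcδ : c δ = -δ) (hδ : δ ≠ 0) {d : F}
    (hd : δ * δ = algebraMap F E d) (hT₀ : T₀.IsSymm) (h : localPi E c (n + n) JD' v) :
    IsSiegelDelta F E c hcδ hδ hd v n hT₀ hJD
        (FrameTransport.frameConj F E c v (n + n) hJD hJD' (swapQ F n) (transpose_swapQ_mul_gramD_mul_swapQ F n) h) ↔
      IsSiegelDelta F E c hcδ hδ hd v n hT₀.neg hJD' h := by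
  rw [isSiegelDelta_iff_blocks, isSiegelDelta_iff_blocks]
  refine forall_congr' fun w => ?_
  rw [reindex_coe_frameConj_swapQ F E c v n hJD hJD' h w, Matrix.toBlocks_fromBlocks₁₁, Matrix.toBlocks_fromBlocks₁₂, Matrix.toBlocks_fromBlocks₂₁,
    Matrix.toBlocks_fromBlocks₂₂]
  constructor
  · intro h'; rw [add_comm, ← h', add_comm]
  · intro h'; rw [add_comm, ← h', add_comm]

/-- **`(Q p Q⁻¹)_Δ = p_Δ` for `p ∈ P_Δ((−T₀)^𝔻)`** (the `Δ`-block `h₂₂ + h₂₁ = h₁₁ + h₁₂` of a Siegel element). [cite: Kudla1994, §3] -/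
theorem deltaBlock_frameConj_swapQ [Algebra.IsQuadraticExtension F E] {δ : E} (hcδ : c δ = -δ) (hδ : δ ≠ 0) {d : F}
    (hd : δ * δ = algebraMap F E d) (hT₀ : T₀.IsSymm) (p : localPi E c (n + n) JD' v)
    (hp : IsSiegelDelta F E c hcδ hδ hd v n hT₀.neg hJD' p) (w : PlacesOver E v) :
    deltaBlock F E c v n w (FrameTransport.frameConj F E c v (n + n) hJD hJD' (swapQ F n) (transpose_swapQ_mul_gramD_mul_swapQ F n) p) =
      deltaBlock F E c v n w p := by
  have hb := (isSiegelDelta_iff_blocks F E c hcδ hδ hd v n hT₀.neg hJD' p).1 hp w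
  unfold deltaBlock
  simp only []
  rw [reindex_coe_frameConj_swapQ F E c v n hJD hJD' p w, Matrix.toBlocks_fromBlocks₁₁, Matrix.toBlocks_fromBlocks₁₂, hb, add_comm]

/-- **`det_Δ (Q p Q⁻¹) = det_Δ p`** for `p ∈ P_Δ((−T₀)^𝔻)`. [cite: Kudla1994, §3] [cite: HarrisKudlaSweet1996, §1 (1.15)] -/
theorem detDelta_frameConj_swapQ [Algebra.IsQuadraticExtension F E] {δ : E} (hcδ : c δ = -δ) (hδ : δ ≠ 0) {d : F}
    (hd : δ * δ = algebraMap F E d) (hT₀ : T₀.IsSymm) (p : localPi E c (n + n) JD' v)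
    (hp : IsSiegelDelta F E c hcδ hδ hd v n hT₀.neg hJD' p) (w : PlacesOver E v) :
    detDelta F E c v n w (FrameTransport.frameConj F E c v (n + n) hJD hJD' (swapQ F n) (transpose_swapQ_mul_gramD_mul_swapQ F n) p) =
      detDelta F E c v n w p := by
  unfold detDelta
  rw [deltaBlock_frameConj_swapQ F E c v n hJD hJD' hcδ hδ hd hT₀ p hp w]

/-- **`χ_v(det_Δ (Q p Q⁻¹)) = χ_v(det_Δ p)`** for `p ∈ P_Δ((−T₀)^𝔻)`. [cite: HarrisKudlaSweet1996, §1 (1.15)] -/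
theorem chiDet_frameConj_swapQ [Algebra.IsQuadraticExtension F E] {δ : E} (hcδ : c δ = -δ) (hδ : δ ≠ 0) {d : F}
    (hd : δ * δ = algebraMap F E d) (hT₀ : T₀.IsSymm) (χv : ∀ w : PlacesOver E v, (w.1.adicCompletion E)ˣ →* ℂˣ)
    (p : localPi E c (n + n) JD' v) (hp : IsSiegelDelta F E c hcδ hδ hd v n hT₀.neg hJD' p) :
    chiDet F E c v n χv (FrameTransport.frameConj F E c v (n + n) hJD hJD' (swapQ F n) (transpose_swapQ_mul_gramD_mul_swapQ F n) p) =
      chiDet F E c v n χv p := by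
  classical
  unfold chiDet
  refine Finset.prod_congr rfl fun w _ => ?_
  have e := detDelta_frameConj_swapQ F E c v n hJD hJD' hcδ hδ hd hT₀ p hp w
  by_cases hu : IsUnit (detDelta F E c v n w p)
  · have hu' : IsUnit (detDelta F E c v n w (FrameTransport.frameConj F E c v (n + n) hJD hJD' (swapQ F n)
        (transpose_swapQ_mul_gramD_mul_swapQ F n) p)) := by rw [e]; exact hu
    have hunit : hu'.unit = hu.unit := Units.ext (by rw [IsUnit.unit_spec, IsUnit.unit_spec, e])
    rw [dif_pos hu', dif_pos hu, hunit]
  · have hu' : ¬ IsUnit (detDelta F E c v n w (FrameTransport.frameConj F E c v (n + n) hJD hJD' (swapQ F n)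
        (transpose_swapQ_mul_gramD_mul_swapQ F n) p)) := by rw [e]; exact hu
    rw [dif_neg hu', dif_neg hu]

end PlaceBlocks

/-! ## §3 `Ad(Q)(g ⊕ 1) = 1 ⊕ g`, `frameW_Q` preserves `ℓ_Δ`, `frameOp_Q (f₁ ⊠ f₂) = f₂ ⊠ f₁` -/

section Swap

variable {J' : Matrix (Fin n) (Fin n) E} (hJ' : J' = (-T₀).map (algebraMap F E))

/-- **`Q (g ⊕ 1) Q⁻¹ = 1 ⊕ g`**: the swap conjugation carries the first-block embedding of the doubled datum of `−T₀` (★ `inlLoc`) to the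
second-block embedding of the doubled datum of `T₀` (★ `BlockSum.inrLoc` along `T₀ ⊕ᶠ (−T₀)`). [cite: Kudla1994, §2 (doubled space, Siegel parabolic)] -/
theorem frameConj_swapQ_inlLoc (g : localPi E c n J' v) :
    FrameTransport.frameConj F E c v (n + n) hJD hJD' (swapQ F n) (transpose_swapQ_mul_gramD_mul_swapQ F n) (inlLoc F E c v n hJ' hJD' g) =
      BlockSum.inrLoc F E c v n n hJ' (hJD_finSum F E n hJD) g := by
  refine Subtype.ext (funext fun w => Units.ext ?_)
  apply (Matrix.reindex (e₂ n).symm (e₂ n).symm).injective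
  rw [reindex_coe_frameConj_swapQ F E c v n hJD hJD' _ w, inlLoc_apply, BlockSum.inrLoc_apply, UnitaryGroup.coe_reindexGL,
    UnitaryGroup.coe_blockDiagGL, UnitaryGroup.coe_reindexGL, UnitaryGroup.coe_blockDiagGL, Units.val_one]
  simp only [Matrix.reindex_apply, Matrix.submatrix_submatrix, Equiv.symm_symm, Equiv.symm_comp_self, Matrix.submatrix_id_id,
    Matrix.toBlocks_fromBlocks₁₁, Matrix.toBlocks_fromBlocks₁₂, Matrix.toBlocks_fromBlocks₂₁, Matrix.toBlocks_fromBlocks₂₂]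

/-- halves of `Q u`: `(Q u)|_L = u|_R`, `(Q u)|_R = u|_L`. [cite: Weil1964, n° 34] -/
theorem resL_resR_frameLin_swapQ (u : Fin (n + n) → v.adicCompletion F) :
    resL (e₂ n) (FrameTransport.frameLin F v (n + n) (swapQ F n) u) = resR (e₂ n) u ∧
      resR (e₂ n) (FrameTransport.frameLin F v (n + n) (swapQ F n) u) = resL (e₂ n) u := by
  rw [FrameTransport.frameLin_apply, map_coe_swapQ, Matrix.reindex_apply, Matrix.submatrix_mulVec_equiv, Equiv.symm_symm, Matrix.fromBlocks_mulVec]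
  simp only [Matrix.zero_mulVec, Matrix.one_mulVec, add_zero, zero_add]
  constructor
  · funext i
    rw [resL_apply, Function.comp_apply, Equiv.symm_apply_apply, Sum.elim_inl]
    rfl
  · funext i
    rw [resR_apply, Function.comp_apply, Equiv.symm_apply_apply, Sum.elim_inr]
    rfl

/-- halves of `Q⁻¹ u` (the same, `Q⁻¹ = Q`). [cite: Weil1964, n° 34] -/
theorem resL_resR_frameLin_swapQ_symm (u : Fin (n + n) → v.adicCompletion F) :
    resL (e₂ n) ((FrameTransport.frameLin F v (n + n) (swapQ F n)).symm u) = resR (e₂ n) u ∧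
      resR (e₂ n) ((FrameTransport.frameLin F v (n + n) (swapQ F n)).symm u) = resL (e₂ n) u := by
  have h : (FrameTransport.frameLin F v (n + n) (swapQ F n)).symm u = FrameTransport.frameLin F v (n + n) (swapQ F n) u := by
    rw [FrameTransport.frameLin_symm_apply, FrameTransport.frameLin_apply, FrameTransport.framePv, ← map_inv, swapQ_inv]
    rfl
  rw [h]
  exact resL_resR_frameLin_swapQ F v n u

/-- **`frameW_Q` preserves `ℓ_Δ`** (the swap respects «both halves equal»). [cite: HarrisKudlaSweet1996, §1 (1.11)] [cite: Kudla1994, §2] -/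
theorem map_frameW_swapQ_deltaLagrangian :
    (deltaLagrangian F v n).map ((FrameTransport.frameW F v (n + n) (swapQ F n) :
        ((Fin (n + n) → v.adicCompletion F) × (Fin (n + n) → v.adicCompletion F)) ≃ₗ[v.adicCompletion F]
          ((Fin (n + n) → v.adicCompletion F) × (Fin (n + n) → v.adicCompletion F))) :
        ((Fin (n + n) → v.adicCompletion F) × (Fin (n + n) → v.adicCompletion F)) →ₗ[v.adicCompletion F]
          ((Fin (n + n) → v.adicCompletion F) × (Fin (n + n) → v.adicCompletion F))) = deltaLagrangian F v n := by
  refine map_eq_of_mapsTo' _ _ (fun x hx => ?_) (fun x hx => ?_)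
  · rw [mem_deltaLagrangian_iff] at hx ⊢
    have h1 := resL_resR_frameLin_swapQ F v n x.1
    have h2 := resL_resR_frameLin_swapQ F v n x.2
    change resL (e₂ n) x.1 = resR (e₂ n) x.1 ∧ resL (e₂ n) x.2 = resR (e₂ n) x.2 at hx
    change resL (e₂ n) (FrameTransport.frameLin F v (n + n) (swapQ F n) x.1) = resR (e₂ n) (FrameTransport.frameLin F v (n + n) (swapQ F n) x.1) ∧
      resL (e₂ n) (FrameTransport.frameLin F v (n + n) (swapQ F n) x.2) = resR (e₂ n) (FrameTransport.frameLin F v (n + n) (swapQ F n) x.2)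
    rw [h1.1, h1.2, h2.1, h2.2, hx.1, hx.2]
    exact ⟨rfl, rfl⟩
  · rw [mem_deltaLagrangian_iff] at hx ⊢
    have h1 := resL_resR_frameLin_swapQ_symm F v n x.1
    have h2 := resL_resR_frameLin_swapQ_symm F v n x.2
    change resL (e₂ n) x.1 = resR (e₂ n) x.1 ∧ resL (e₂ n) x.2 = resR (e₂ n) x.2 at hx
    change resL (e₂ n) ((FrameTransport.frameLin F v (n + n) (swapQ F n)).symm x.1) =
        resR (e₂ n) ((FrameTransport.frameLin F v (n + n) (swapQ F n)).symm x.1) ∧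
      resL (e₂ n) ((FrameTransport.frameLin F v (n + n) (swapQ F n)).symm x.2) =
        resR (e₂ n) ((FrameTransport.frameLin F v (n + n) (swapQ F n)).symm x.2)
    rw [h1.1, h1.2, h2.1, h2.2, hx.1, hx.2]
    exact ⟨rfl, rfl⟩

/-- **`frameMp_Q` carries movers to movers**: if `π(m)` carries `ℓ_Δ` onto `ℓ_Y` in `𝕎^𝔻_{−T₀}`, then `π(frameMp_Q m)` does so in `𝕎^𝔻_{T₀}`.
[cite: MoeglinVignerasWaldspurger1987, Chap. 2 II Remarque (3)] [cite: Kudla1994, Thm 3.1] -/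
theorem map_proj_frameMp_swapQ_deltaLagrangian (m : LocalMp F (n + n) (gramD F n (-T₀)) v)
    (hm : (deltaLagrangian F v n).map (toLin F v (MpPsi.proj _ m)) = lagrangianY F (n + n) v) :
    (deltaLagrangian F v n).map (toLin F v (MpPsi.proj _
      (FrameTransport.frameMp F v (n + n) (swapQ F n) (transpose_swapQ_mul_gramD_mul_swapQ F n) m))) = lagrangianY F (n + n) v := by
  rw [FrameTransport.proj_frameMp, FrameTransport.frameSp, toLin, coe_symplecticConj, LinearEquiv.coe_trans, LinearEquiv.coe_trans,
    Submodule.map_comp, Submodule.map_comp]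
  have h1 : (deltaLagrangian F v n).map (((FrameTransport.frameW F v (n + n) (swapQ F n)).symm :
      ((Fin (n + n) → v.adicCompletion F) × (Fin (n + n) → v.adicCompletion F)) ≃ₗ[v.adicCompletion F]
        ((Fin (n + n) → v.adicCompletion F) × (Fin (n + n) → v.adicCompletion F))) :
      ((Fin (n + n) → v.adicCompletion F) × (Fin (n + n) → v.adicCompletion F)) →ₗ[v.adicCompletion F]
        ((Fin (n + n) → v.adicCompletion F) × (Fin (n + n) → v.adicCompletion F))) = deltaLagrangian F v n := by
    conv_lhs => rw [← map_frameW_swapQ_deltaLagrangian F v n, ← Submodule.map_comp]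
    rw [← LinearEquiv.coe_trans, LinearEquiv.self_trans_symm, LinearEquiv.refl_toLinearMap, Submodule.map_id]
  rw [h1]
  change ((deltaLagrangian F v n).map (toLin F v (MpPsi.proj _ m))).map _ = _
  rw [hm, map_frameW_lagrangianY]

/-- **`frameOp_Q (f₁ ⊠ f₂) = f₂ ⊠ f₁`**: the frame operator of the swap exchanges the two tensor factors of a product vector.
[cite: MoeglinVignerasWaldspurger1987, Chap. 2 II.1 Rem. (6)] -/
theorem frameOp_swapQ_boxSB (f₁ f₂ : SchwartzBruhat (Fin n → v.adicCompletion F)) :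
    FrameTransport.frameOp F v (n + n) (swapQ F n) (boxSB (v.adicCompletion F) (e₂ n) f₁ f₂) = boxSB (v.adicCompletion F) (e₂ n) f₂ f₁ := by
  apply Subtype.ext
  funext u
  have h := resL_resR_frameLin_swapQ_symm F v n u
  rw [FrameTransport.coe_frameOp_apply, coe_boxSB, coe_boxSB]
  dsimp only
  rw [h.1, h.2, mul_comm]

end Swap

end Literature.NumberTheory.GelbartRogawski1991.UnitaryDualPair.LocalSplitting

end
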